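import Literature.NumberTheory.Automorphic.IrreducibleClasses   -- ★ `SmoothIrrep`, `IrrClass.mk`, `IrrClass.mk_eq_mk_iff`, `SmoothIrrep.instIsIrreducible`
import Mathlib.RepresentationTheory.Irreducible                -- Mathlib Schur: `IsIrreducible.bijective_or_eq_zero`, `IntertwiningMap.ofBijective`
import HarnessLib

/-!
# Schur's lemma for classes: distinct irreducible classes have no non-zero intertwiner (`Hom_G(r, r′) = 0` for `[r] ≠ [r′]`)

Topic `NumberTheory/Automorphic`; namespaces `Literature.NumberTheory.Automorphic.SmoothIrrep` ∕ `IrrClass` (dot-lemmas next to ★ `IrreducibleClasses`).  THEOREMS ONLY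
(no definition, no named fact, no instance, no notation, no `sorry`).  Mathlib already proves Schur's alternative for Mathlib's `Representation.IntertwiningMap` of irreducibles
(`Representation.IsIrreducible.bijective_or_eq_zero`: an intertwiner between irreducibles is bijective or zero; `Representation.IntertwiningMap.ofBijective` packages a bijective one as a
`Representation.Equiv`; and the instance `[IsIrreducible σ] [IsEmpty (Equiv ρ σ)] : Subsingleton (IntertwiningMap ρ σ)`); this file reads it in the tree's CLASS currency ★ `IrrClass.mk_eq_mk_iff`
(`mk r = mk r′ ↔ Nonempty (r.ρ.Equiv r′.ρ)`): for bundled irreducible smooth representations `r r′ : SmoothIrrep G` with DIFFERENT classes, `IsEmpty (r.ρ.Equiv r′.ρ)`, every intertwiner `r.ρ → r′.ρ` is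
`0`, and `Hom_G(r, r′)` is a subsingleton (so `dim Hom_G(r, r′) = 0`).  Cell `hodgecm-mathlib`, E1 EXT-ROAD «(b)-REST NOT-WILD» item (5) HOM-ZERO (LEAD F0P3a-plan (g17) T16-03): the letter
`hHom0 : Subsingleton (r.ρ.IntertwiningMap r′.ρ)` of ★ row 80 (X0′) ∕ ★ 79 (SEP) at `IrrClass.mk r ≠ IrrClass.mk r′`.  Seat «LH6» LH6-p04 (g12).
HONEST LABEL: count-neutral generic helper; HC_CM is proved only modulo the printed citations until rung 0 closes.

## References
* [BushnellHenniart2006] C. J. Bushnell, G. Henniart, *The local Langlands conjecture for GL(2)*, Grundlehren 335 (2006), §1.1–§1.2, §2.6 (Schur's lemma for irreducible smooth representations).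
* [BernsteinZelevinsky1976] I. N. Bernstein, A. V. Zelevinsky, Russian Math. Surveys 31:3 (1976), §2.11 (Schur's lemma).
-/

set_option autoImplicit false

namespace Literature.NumberTheory.Automorphic

universe u

variable {G : Type u} [Group G] [TopologicalSpace G]

/-- **Distinct classes ⇒ no isomorphism**: `IrrClass.mk r ≠ IrrClass.mk r′` makes `r.ρ.Equiv r′.ρ` empty (★ `IrrClass.mk_eq_mk_iff`). [cite: BushnellHenniart2006, §1.1–1.2] -/
theorem SmoothIrrep.isEmpty_equiv_of_mk_ne_mk (r r' : SmoothIrrep G) (hne : IrrClass.mk r ≠ IrrClass.mk r') : IsEmpty (r.ρ.Equiv r'.ρ) :=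
  ⟨fun e => hne ((IrrClass.mk_eq_mk_iff r r').2 ⟨e⟩)⟩

/-- **SCHUR FOR DISTINCT CLASSES: every intertwiner `r.ρ → r′.ρ` is zero** when `IrrClass.mk r ≠ IrrClass.mk r′` (Mathlib `IsIrreducible.bijective_or_eq_zero`: a non-zero intertwiner
between irreducibles is bijective, hence an `Equiv`, hence the classes coincide). [cite: BushnellHenniart2006, §2.6] [cite: BernsteinZelevinsky1976, §2.11] -/
theorem SmoothIrrep.intertwiningMap_eq_zero_of_mk_ne_mk (r r' : SmoothIrrep G) (hne : IrrClass.mk r ≠ IrrClass.mk r')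
    (f : r.ρ.IntertwiningMap r'.ρ) : f = 0 := by
  rcases Representation.IsIrreducible.bijective_or_eq_zero f with h | h
  · exact ((SmoothIrrep.isEmpty_equiv_of_mk_ne_mk r r' hne).false (Representation.IntertwiningMap.ofBijective f h)).elim
  · exact h

/-- **`Hom_G(r, r′)` IS A SUBSINGLETON for distinct classes** — the letter `hHom0 : Subsingleton (r.ρ.IntertwiningMap r′.ρ)` of the cross-trace ∕ block-separation files, from
`IrrClass.mk r ≠ IrrClass.mk r′` (Mathlib's instance `[IsIrreducible σ] [IsEmpty (Equiv ρ σ)] : Subsingleton (IntertwiningMap ρ σ)`). [cite: BushnellHenniart2006, §2.6]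
[cite: BernsteinZelevinsky1976, §2.11] -/
theorem SmoothIrrep.subsingleton_intertwiningMap_of_mk_ne_mk (r r' : SmoothIrrep G) (hne : IrrClass.mk r ≠ IrrClass.mk r') :
    Subsingleton (r.ρ.IntertwiningMap r'.ρ) :=
  haveI := SmoothIrrep.isEmpty_equiv_of_mk_ne_mk r r' hne
  inferInstance

/-- `dim_ℂ Hom_G(r, r′) = 0` for distinct classes. [cite: BushnellHenniart2006, §2.6] -/
theorem SmoothIrrep.finrank_intertwiningMap_eq_zero_of_mk_ne_mk (r r' : SmoothIrrep G) (hne : IrrClass.mk r ≠ IrrClass.mk r') :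
    Module.finrank ℂ (r.ρ.IntertwiningMap r'.ρ) = 0 :=
  haveI := SmoothIrrep.subsingleton_intertwiningMap_of_mk_ne_mk r r' hne
  Module.finrank_zero_of_subsingleton

/-- Class form, symmetric in use: for `c ≠ c′` and ANY representatives `r` of `c`, `r′` of `c′`, `Hom_G(r, r′)` is a subsingleton. [cite: BushnellHenniart2006, §2.6] -/
theorem IrrClass.subsingleton_intertwiningMap_of_ne {c c' : IrrClass G} (hne : c ≠ c') (r r' : SmoothIrrep G)
    (hr : IrrClass.mk r = c) (hr' : IrrClass.mk r' = c') : Subsingleton (r.ρ.IntertwiningMap r'.ρ) :=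
  SmoothIrrep.subsingleton_intertwiningMap_of_mk_ne_mk r r' (by rw [hr, hr']; exact hne)

end Literature.NumberTheory.Automorphic
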